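import Mathlib
import Literature.Barriers.ValiantsHypothesis.AlgebraicNaturalProofs
import Summits.ValiantsHypothesis.ValiantsHypothesis.Theorems.BarrierLeverSuccinctHittingSetsForVPDimensionCount
import Summits.ValiantsHypothesis.ValiantsHypothesis.Theorems.BarrierLeverReadOnceDeterminantsHitByVPOfCrux
import Summits.ValiantsHypothesis.ValiantsHypothesis.Theses.BarrierLever

/-!
# Route BarrierLever — LADDER ARROWS onto item `PartitionMinorsHitByVP` (stmt-ValiantsHypothesis-19717)
# from item `ReadOnceDeterminantsHitByVP` (stmt-20152), from the crux (stmt-14610), and from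
# item `ChowHitsReadOnceDeterminants` (stmt-20239)

Helper file (`--supports stmt-ValiantsHypothesis-19717`; cell val-lit seat val-lit-p1). Lean text of the
cell planner valiant-natproofs p1 (gen 6, `HOME/p1/PartitionMinors-g6.lean`, farm rc 0, cited in the
item's docstring as «KERNEL-CHECKED ARROWS»), ported against the ROUTE decls. Closes NO item.

Variables `x_a := X (Fin.castAdd h a)`, `y_c := X (Fin.natAdd h c)` of `MvPolynomial (Fin (h+h)) ℂ`;
Nisan's partition matrix `M_f[u, w] = coeff_{x^u y^w} f`; item 19717 asks that every square MINOR
`[U, W]` (injective families `u, w` of `r` subsets) be nonsingular at some `f ∈ SmallCircuits ℂ (h+h) b`.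
Such a minor IS a constant-free read-once determinantal layout (`(i,j) ↦ x^{u i} y^{w j}` is injective,
`pmono_inj`; `r ≤ 2^h ≤ C(4h, 2h)`, `card_le_two_pow` + the tree's `two_pow_le_choose`), and it is
nonzero (evaluate at the "diagonal" coefficient vector), so:

* `partitionMinorsHitByVP_of_readOnceDeterminantsHitByVP` — item 20152 ⇒ item 19717 (level `a = 1`);
* `partitionMinorsHitByVP_of_succinctHittingSetsForVP` — crux 14610 ⇒ item 19717 (through the landed
  `readOnceDeterminantsHitByVP_of_crux`);
* `chowHitsPartitionMinors_of_chowHitsReadOnceDeterminants` — item 20239 ⇒ "ONE product of `2h` affine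
  forms makes every partition minor nonsingular" (the cell's sharper conjecture, inlined; not an item).

WHAT THIS IS NOT: none of 19717 / 20152 / 20239 / 14610 is proved; the torus-balanced minors remain the
open residue (see `…TorusIsolation`, `…PartitionMinorsHitByVPChain` for the rungs that ARE proved).

References: [ForbesShpilkaVolk2018] §8 (read-once determinants); Nisan 1991 (partition matrices).
-/

-- layout Summits/ValiantsHypothesis/ValiantsHypothesis forces the duplicated namespace component
set_option linter.dupNamespace false

noncomputable section

namespace Summit.ValiantsHypothesis.ValiantsHypothesis.Theorems.BarrierLever.PartitionMinorsOfReadOnce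

open MvPolynomial Literature.Barriers.ValiantsHypothesis

/-- Exponent vector of the multilinear monomial `x^u y^w` (plumbing). [folklore] -/
noncomputable def pmono (h : ℕ) (u w : Finset (Fin h)) : Fin (h + h) →₀ ℕ :=
  ∑ a ∈ u, Finsupp.single (Fin.castAdd h a) 1 + ∑ c ∈ w, Finsupp.single (Fin.natAdd h c) 1

/-! ### The monomial map `(u, w) ↦ x^u y^w` -/

/-- `x^u y^w` has exponent `[a ∈ u]` at `x_a`. [folklore] -/
theorem pmono_apply_castAdd {h : ℕ} (u w : Finset (Fin h)) (a : Fin h) :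
    pmono h u w (Fin.castAdd h a) = if a ∈ u then 1 else 0 := by
  classical
  simp only [pmono, Finsupp.coe_add, Finsupp.coe_finsetSum, Pi.add_apply, Finset.sum_apply,
    Finsupp.single_apply]
  have h1 : (∑ x ∈ u, if Fin.castAdd h x = Fin.castAdd h a then (1 : ℕ) else 0) =
      if a ∈ u then 1 else 0 := by
    have : ∀ x ∈ u, (if Fin.castAdd h x = Fin.castAdd h a then (1 : ℕ) else 0) =
        if x = a then 1 else 0 := by
      intro x _
      simp [(Fin.castAdd_injective h h).eq_iff]
    rw [Finset.sum_congr rfl this, Finset.sum_ite_eq']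
  have h2 : (∑ x ∈ w, if Fin.natAdd h x = Fin.castAdd h a then (1 : ℕ) else 0) = 0 := by
    refine Finset.sum_eq_zero fun x _ => ?_
    have : Fin.natAdd h x ≠ Fin.castAdd h a := by
      intro heq
      have := congrArg Fin.val heq
      simp [Fin.natAdd, Fin.castAdd] at this
      omega
    exact if_neg this
  rw [h1, h2, add_zero]

/-- `x^u y^w` has exponent `[c ∈ w]` at `y_c`. [folklore] -/
theorem pmono_apply_natAdd {h : ℕ} (u w : Finset (Fin h)) (c : Fin h) :
    pmono h u w (Fin.natAdd h c) = if c ∈ w then 1 else 0 := by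
  classical
  simp only [pmono, Finsupp.coe_add, Finsupp.coe_finsetSum, Pi.add_apply, Finset.sum_apply,
    Finsupp.single_apply]
  have h1 : (∑ x ∈ w, if Fin.natAdd h x = Fin.natAdd h c then (1 : ℕ) else 0) =
      if c ∈ w then 1 else 0 := by
    have : ∀ x ∈ w, (if Fin.natAdd h x = Fin.natAdd h c then (1 : ℕ) else 0) =
        if x = c then 1 else 0 := by
      intro x _
      simp
    rw [Finset.sum_congr rfl this, Finset.sum_ite_eq']
  have h2 : (∑ x ∈ u, if Fin.castAdd h x = Fin.natAdd h c then (1 : ℕ) else 0) = 0 := by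
    refine Finset.sum_eq_zero fun x _ => ?_
    have : Fin.castAdd h x ≠ Fin.natAdd h c := by
      intro heq
      have := congrArg Fin.val heq
      simp [Fin.natAdd, Fin.castAdd] at this
      omega
    exact if_neg this
  rw [h2, h1, zero_add]

/-- `(u, w) ↦ x^u y^w` is injective. [folklore] -/
theorem pmono_inj {h : ℕ} {u w u' w' : Finset (Fin h)} (heq : pmono h u w = pmono h u' w') :
    u = u' ∧ w = w' := by
  constructor
  · ext a
    have := congrArg (fun m => m (Fin.castAdd h a)) heq
    simp only [pmono_apply_castAdd] at this
    by_cases ha : a ∈ u <;> by_cases ha' : a ∈ u' <;> simp_all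
  · ext c
    have := congrArg (fun m => m (Fin.natAdd h c)) heq
    simp only [pmono_apply_natAdd] at this
    by_cases hc : c ∈ w <;> by_cases hc' : c ∈ w' <;> simp_all

/-- `deg x^u y^w ≤ 2h`. [folklore] -/
theorem degree_pmono_le {h : ℕ} (u w : Finset (Fin h)) : (pmono h u w).degree ≤ h + h := by
  simp only [pmono, map_add, map_sum, Finsupp.degree_single, Finset.sum_const, smul_eq_mul, mul_one]
  have hu : u.card ≤ h := by simpa using Finset.card_le_univ u
  have hw : w.card ≤ h := by simpa using Finset.card_le_univ w
  omega

/-- `x^u y^w` as an element of `degLEMonomials (h + h)` (plumbing). [folklore] -/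
noncomputable def pmonoLE (h : ℕ) (u w : Finset (Fin h)) : ↥(degLEMonomials (h + h)) :=
  ⟨pmono h u w, degree_pmono_le u w⟩

/-- The layout map of a partition minor is injective (read-once). [folklore] -/
theorem beta_injective {h r : ℕ} {u w : Fin r → Finset (Fin h)} (hu : Function.Injective u)
    (hw : Function.Injective w) :
    Function.Injective (fun p : Fin r × Fin r => pmonoLE h (u p.1) (w p.2)) := by
  intro p q hpq
  have := pmono_inj (congrArg Subtype.val hpq)
  exact Prod.ext (hu this.1) (hw this.2)

/-- A partition minor has size `r ≤ 2^h`. [folklore] -/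
theorem card_le_two_pow {h r : ℕ} {u : Fin r → Finset (Fin h)} (hu : Function.Injective u) :
    r ≤ 2 ^ h := by
  simpa [Fintype.card_finset] using Fintype.card_le_of_injective u hu

/-! ### Arrow 1: item 20239 ⟹ one Chow point hits every partition minor -/

/-- **Item 20239 ⇒ the cell's sharper conjecture for partition minors**: if one product of `n` affine
forms hits every injective constant-free read-once layout (for all large `n`), then for all large `h` ONE
product of `2h` affine forms in `x, y` makes every Nisan partition minor nonsingular.
[cite: ForbesShpilkaVolk2018, §8] -/
theorem chowHitsPartitionMinors_of_chowHitsReadOnceDeterminants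
    (H : Theses.BarrierLever.ChowHitsReadOnceDeterminants) :
    ∃ h₀ : ℕ, ∀ h : ℕ, h₀ ≤ h → ∀ (r : ℕ) (u w : Fin r → Finset (Fin h)),
      Function.Injective u → Function.Injective w →
        ∃ ℓ : Fin (h + h) → MvPolynomial (Fin (h + h)) ℂ, (∀ k, (ℓ k).totalDegree ≤ 1) ∧
          (Matrix.of fun i j : Fin r =>
            MvPolynomial.coeff
              (∑ a ∈ u i, Finsupp.single (Fin.castAdd h a) 1 +
                ∑ c ∈ w j, Finsupp.single (Fin.natAdd h c) 1) (∏ k, ℓ k)).det ≠ 0 := by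
  unfold Summit.ValiantsHypothesis.ValiantsHypothesis.Theses.BarrierLever.ChowHitsReadOnceDeterminants at H
  obtain ⟨n₀, H⟩ := H
  refine ⟨n₀, fun h hh r u w hu hw => ?_⟩
  obtain ⟨ℓ, hℓ, hdet⟩ := H (h + h) (by omega) r (fun p => pmonoLE h (u p.1) (w p.2))
    (beta_injective hu hw)
  exact ⟨ℓ, hℓ, by simpa [pmonoLE, pmono] using hdet⟩

/-! ### Arrow 2: item 20152 ⟹ item 19717 -/

/-- Evaluating the layout determinant at a coefficient vector gives the minor of `f`. [folklore] -/
theorem eval_det_layout {n r : ℕ} (β : Fin r × Fin r → ↥(degLEMonomials n))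
    (v : ↥(degLEMonomials n) → ℂ) :
    eval v ((Matrix.of fun i j : Fin r =>
        (Sum.inl (β (i, j)) : ↥(degLEMonomials n) ⊕ ℂ)).map (Sum.elim MvPolynomial.X MvPolynomial.C)).det
      = (Matrix.of fun i j : Fin r => v (β (i, j))).det := by
  rw [RingHom.map_det]
  congr 1
  ext i j
  simp

/-- **Item 20152 ⇒ item 19717** (signatures = the route decls): read-once determinants hit by `VP`
at level `a = 1` already cover every partition minor (`r ≤ 2^h ≤ C(4h,2h)`, read-once by `pmono_inj`,
nonzero at the diagonal point). [cite: ForbesShpilkaVolk2018, §8] -/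
theorem partitionMinorsHitByVP_of_readOnceDeterminantsHitByVP
    (H : Theses.BarrierLever.ReadOnceDeterminantsHitByVP) :
    Theses.BarrierLever.PartitionMinorsHitByVP := by
  unfold Summit.ValiantsHypothesis.ValiantsHypothesis.Theses.BarrierLever.PartitionMinorsHitByVP
  unfold Summit.ValiantsHypothesis.ValiantsHypothesis.Theses.BarrierLever.ReadOnceDeterminantsHitByVP at H
  obtain ⟨b, n₀, Hn⟩ := H 1
  refine ⟨b, max n₀ 2, fun h hh r u w hu hw => ?_⟩
  have hn : n₀ ≤ h + h := by omega
  have h4 : 4 ≤ h + h := by omega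
  classical
  -- the layout
  set β : Fin r × Fin r → ↥(degLEMonomials (h + h)) := fun p => pmonoLE h (u p.1) (w p.2) with hβ
  have hβinj : Function.Injective β := beta_injective hu hw
  set E : Matrix (Fin r) (Fin r) (↥(degLEMonomials (h + h)) ⊕ ℂ) :=
    Matrix.of fun i j => Sum.inl (β (i, j)) with hE
  set D := (E.map (Sum.elim MvPolynomial.X MvPolynomial.C)).det with hD
  -- membership in the read-once determinant class of item 20152 (a = 1)
  have hmem : D ∈ {D | ∃ (r : ℕ) (E : Matrix (Fin r) (Fin r) (↥(degLEMonomials (h + h)) ⊕ ℂ)),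
        r ≤ (Nat.choose (2 * (h + h)) (h + h)) ^ 1 ∧
        (∀ p q : Fin r × Fin r, ∀ m, E p.1 p.2 = Sum.inl m → E q.1 q.2 = Sum.inl m → p = q) ∧
        D = (E.map (Sum.elim MvPolynomial.X MvPolynomial.C)).det} := by
    refine ⟨r, E, ?_, ?_, rfl⟩
    · have h1 : r ≤ 2 ^ h := card_le_two_pow hu
      have h2 : 2 ^ h ≤ 2 ^ (h + h) := Nat.pow_le_pow_right (by norm_num) (by omega)
      have h3 : 2 ^ (h + h) ≤ Nat.choose (2 * (h + h)) (h + h) :=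
        Summit.ValiantsHypothesis.ValiantsHypothesis.Theorems.BarrierLever.SuccinctHittingSetsForVP.LowDegreeEquations.two_pow_le_choose h4
      simpa using h1.trans (h2.trans h3)
    · intro p q m hp hq
      have hp' : β (p.1, p.2) = m := by simpa [hE] using hp
      have hq' : β (q.1, q.2) = m := by simpa [hE] using hq
      have := hβinj (hp'.trans hq'.symm)
      simpa using this
  -- D ≠ 0: evaluate at the "diagonal" point
  have hD0 : D ≠ 0 := by
    intro h0
    let v : ↥(degLEMonomials (h + h)) → ℂ := fun m => if ∃ i, β (i, i) = m then 1 else 0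
    have hev : eval v D = (Matrix.of fun i j : Fin r => v (β (i, j))).det := by
      rw [hD, hE]; exact eval_det_layout β v
    have hone : (Matrix.of fun i j : Fin r => v (β (i, j))) = 1 := by
      ext i j
      by_cases hij : i = j
      · subst hij
        simp [v]
      · have : ¬ ∃ k, β (k, k) = β (i, j) := by
          rintro ⟨k, hk⟩
          have := hβinj hk
          simp only [Prod.mk.injEq] at this
          exact hij (this.1.symm.trans this.2)
        simp [v, hij, this]
    rw [h0, map_zero, hone, Matrix.det_one] at hev
    exact zero_ne_one hev
  obtain ⟨f, hf, hne⟩ := Hn (h + h) hn D hmem hD0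
  refine ⟨f, hf, ?_⟩
  have hev : eval (coeffVector (degLEMonomials (h + h)) f) D =
      (Matrix.of fun i j : Fin r => coeffVector (degLEMonomials (h + h)) f (β (i, j))).det := by
    rw [hD, hE]; exact eval_det_layout β _
  rw [hev] at hne
  simpa [coeffVector, hβ, pmonoLE, pmono] using hne


/-! ### Arrow 3: the crux ⟹ item 19717 -/

/-- **Crux 14610 ⇒ item 19717**, through the landed `readOnceDeterminantsHitByVP_of_crux`
(crux ⇒ item 20152). [cite: ForbesShpilkaVolk2018, Question 6 and §8] -/
theorem partitionMinorsHitByVP_of_succinctHittingSetsForVP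
    (h : Theses.BarrierLever.SuccinctHittingSetsForVP) : Theses.BarrierLever.PartitionMinorsHitByVP :=
  partitionMinorsHitByVP_of_readOnceDeterminantsHitByVP
    (ReadOnceDeterminantsHitByVP.readOnceDeterminantsHitByVP_of_crux h)

end Summit.ValiantsHypothesis.ValiantsHypothesis.Theorems.BarrierLever.PartitionMinorsOfReadOnce

end
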